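import Summits.Ventures.PackingBounds.Energy.TenPointCkSixGramDataL1
import Summits.Ventures.PackingBounds.Energy.TenPointCkSixGramDataL2
import HarnessLib

/-!
# Integer Gram data `S·Y = L Lᵀ + E` (the rows of L: the table (collector of 2 part modules)) of the 153 × 153 SOS block of the exact sharp three-point certificate
# `e3pt-sharp-n4N10ck6d8-rat.json` (two orthogonal regular pentagons (4,10); ten points on S³, single SOS term, d = 8)

Framing: lottery ticket; floor = certified bounds/negative ranges. Venture `PackingBounds`, cell `pub-packcert`, energy family E3PT
(pub-packcert-energy gen 15; KERNEL-D6 data route). `yW6` = S·Y (S = `scaleW6` = lcm of denominators · 2^40), `lW6` = rounded scaled Cholesky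
factor, `eW6` = S·Y − lW6·lW6ᵀ (exact; symmetric, diagonally dominant). Checked by `decide +kernel` with `GramData.checkRows` / `checkDD`
in `TenPointCkSixGramFacts*`; generator `pub-packcert-energy/code/e3pt/g15/e3pt_lean_n4y.py`. (Rows split in independent modules for the gate's request-size limit; one collector per table.)
-/

namespace Summit.Ventures.PackingBounds.Energy.PentagonsSixD8

/-- data rows. -/
def lW6 : List (List ℤ) := [lW60, lW61, lW62, lW63, lW64, lW65, lW66, lW67, lW68, lW69, lW610, lW611, lW612, lW613, lW614, lW615, lW616, lW617, lW618, lW619, lW620, lW621, lW622, lW623, lW624, lW625, lW626, lW627, lW628, lW629, lW630, lW631, lW632, lW633, lW634, lW635, lW636, lW637, lW638, lW639, lW640, lW641, lW642, lW643, lW644, lW645, lW646, lW647, lW648, lW649, lW650, lW651, lW652, lW653, lW654, lW655, lW656, lW657, lW658, lW659, lW660, lW661, lW662, lW663, lW664, lW665, lW666, lW667, lW668, lW669, lW670, lW671, lW672, lW673, lW674, lW675, lW676, lW677, lW678, lW679, lW680, lW681, lW682, lW683, lW684, lW685, lW686, lW687, lW688, lW689, lW690, lW691, lW692, lW693, lW694,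 lW695, lW696, lW697, lW698, lW699, lW6100, lW6101, lW6102, lW6103, lW6104, lW6105, lW6106, lW6107, lW6108, lW6109, lW6110, lW6111, lW6112, lW6113, lW6114, lW6115, lW6116, lW6117, lW6118, lW6119, lW6120, lW6121, lW6122, lW6123, lW6124, lW6125, lW6126, lW6127, lW6128, lW6129, lW6130, lW6131, lW6132, lW6133, lW6134, lW6135, lW6136, lW6137, lW6138, lW6139, lW6140, lW6141, lW6142, lW6143, lW6144, lW6145, lW6146, lW6147, lW6148, lW6149, lW6150, lW6151, lW6152]

end Summit.Ventures.PackingBounds.Energy.PentagonsSixD8
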